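import Literature.NumberTheory.Irrationality.LaiYu2020.AnalysisLemmaLimit
import Literature.NumberTheory.Irrationality.FischlerSprangZudilin2019.Lemma3Ratio
import Literature.Analysis.SpecialFunctions.GammaVerticalRatio
import HarnessLib

/-!
# Lai–Yu 2020, Lemma 4.1 — part 4: `r_{n,1}/r_{n,θ} → 1`

Topic `Literature/NumberTheory/Irrationality/LaiYu2020`, namespace
`Literature.NumberTheory.Irrationality.LaiYu2020` (helpers in `Lemma41`). Source: L. Lai, P. Yu, *A note on the
number of irrational odd zeta values*, Compositio Math. **156** (2020) 1699–1717 = arXiv:1911.08458 [LaiYu2020],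
§4 Lemma 4.1, second assertion, and its proof (held: `paper:arxiv-1911.08458`, arXiv text p. 9, read on the
page). Last of the files PROVING Lemma 4.1; everything here is proved, no named facts.

## The source, verbatim (the steps formalised here)
"Moreover, for any `θ ∈ 𝓕_B`, we have `lim_{n→+∞} r_{n,1}/r_{n,θ} = 1`." … "To prove the last statement in the
lemma, we first fix an arbitrary (sufficiently) small `ε₀ > 0`. For all `θ ∈ 𝓕_B`, we have
`r_{n,θ} ≥ ∑_{(x₀−ε₀)n ≤ k ≤ (x₀+ε₀)n} R̂_n(k+θ)` (4.10). In view of the estimates (4.6), (4.7) and (4.9), we also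
have `r_{n,θ} ≤ n^{O(1)} max(h(x₀−ε₀), h(x₀+ε₀))ⁿ + ∑_{(x₀−ε₀)n ≤ k ≤ (x₀+ε₀)n} R̂_n(k+θ)
< (1+ε₀) ∑_{(x₀−ε₀)n ≤ k ≤ (x₀+ε₀)n} R̂_n(k+θ)` (4.11), provided `n` is sufficiently large … We now use the fact
that, for any fixed real number `τ`, `Γ(x+τ)/Γ(x) = (1+o_{x→+∞}(1)) x^τ` (4.12). Applying (4.12) to (4.3), we
derive that `R̂_n(k+1)/R̂_n(k+θ) = (1+o(1)) ((κ+2r+1)/κ)^{|𝓕_B|(1−θ)} ((κ+r)/(κ+r+1))^{(s+1)(1−θ)}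
= (1+o(1)) f(κ)^{1−θ}` (4.13) uniformly for `k ∈ [(x₀−ε₀)n, (x₀+ε₀)n]` as `n → +∞`. By (4.10), (4.11) and (4.13)
… Letting `ε₀ → 0⁺`, we deduce that `lim_{n→+∞} r_{n,1}/r_{n,θ} = 1`."

## What is proved here (and the deviation from print)
* DEVIATION (elementary replacement of the Gamma asymptotics (4.12)): the logarithm of the term ratio is
  compared directly with `(1−θ) log f(k/n)`:
  **`abs_log_ratio_sub_le`**: `|log R̂_n(k+1) − log R̂_n(k+θ) − (1−θ) log f(k/n)| ≤ (2 + 4N + 3(s+1))/(k−1)`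
  for all `k ≥ 2`, `θ ∈ (0,1]` (from `y − y² ≤ log(1+y) ≤ y` and the comparison of `∑ 1/(a+j)` with
  logarithms; here `(k+(2r+1)n)/k = (κ+2r+1)/κ` and `(rn+k)/(rn+k+n) = (κ+r)/(κ+r+1)` EXACTLY, `κ = k/n`).
* `window_ratio`: for every `ε > 0` there are `δ > 0` and `M` with `|R̂_n(k+1)/R̂_n(k+θ) − 1| ≤ ε` for all
  `m ≥ M` (`n = vm`), all `k` with `(x₀−δ)n ≤ k ≤ (x₀+δ)n` and all `θ ∈ (0,1]` — the printed (4.13), using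
  `log f(x₀) = 0` and the continuity of `log f`.
* **`tendsto_ratio`**: `r_{n,1}/r_{n,θ} → 1` along `n = vm` for every `θ ∈ (0,1]` — the printed (4.10)–(4.11)
  (off-window part exponentially negligible: `Lam_gap` of `AnalysisLemmaProfile.lean` and the tail (4.9)).
Parameters as in the sibling files: `u, v ≥ 1`, `s ≥ 2`, `(2u+v)|𝓕_B| < (s+1)v`, `x₀` the root of `f`.

Cell zeta5-irr (rung F-Z1): a lemma about the auxiliary series of [LaiYu2020]; nothing here bears on `ζ(5)`.
-/

noncomputable section

open Finset Filter

open scoped Nat Topology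

namespace Literature.NumberTheory.Irrationality.LaiYu2020

open Literature.Analysis.SpecialFunctions (GammaRatio.sub_sq_le_log_one_add)

namespace Lemma41

/-! ### Elementary logarithmic inequalities -/

/-- `log X ≤ log Y + c` when `X ≤ Y(1+c)`, `X, Y > 0`, `c ≥ 0`. [cite: LaiYu2020, §4 proof of Lemma 4.1, eq. (4.12) (elementary form)] -/
theorem log_le_log_add {X Y c : ℝ} (hX : 0 < X) (hY : 0 < Y) (hc : 0 ≤ c) (h : X ≤ Y * (1 + c)) :
    Real.log X ≤ Real.log Y + c := by
  calc Real.log X ≤ Real.log (Y * (1 + c)) := Real.log_le_log hX h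
    _ = Real.log Y + Real.log (1 + c) := Real.log_mul hY.ne' (by linarith)
    _ ≤ Real.log Y + c := by linarith [Real.log_le_sub_one_of_pos (show 0 < 1 + c by linarith)]

/-- `∑_{j<L} 1/(a+j)² ≤ 1/(a−1)` (`a > 1`; telescoping `1/(a+j)² ≤ 1/(a+j−1) − 1/(a+j)`).
[cite: LaiYu2020, §4 proof of Lemma 4.1, eq. (4.12) (elementary form)] -/
theorem sum_inv_sq_le {a : ℝ} (ha : 1 < a) (L : ℕ) : ∑ j ∈ range L, 1 / (a + j) ^ 2 ≤ 1 / (a - 1) := by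
  have key : ∀ j : ℕ, 1 / (a + j) ^ 2 ≤ 1 / (a - 1 + j) - 1 / (a - 1 + ((j + 1 : ℕ) : ℝ)) := by
    intro j
    have hj0 : (0 : ℝ) ≤ j := Nat.cast_nonneg j
    have e : (a - 1 + ((j + 1 : ℕ) : ℝ)) = a + j := by push_cast; ring
    rw [e, div_sub_div _ _ (by linarith) (by linarith), div_le_div_iff₀ (by positivity) (by nlinarith)]
    nlinarith
  calc ∑ j ∈ range L, 1 / (a + j) ^ 2 ≤ ∑ j ∈ range L, (1 / (a - 1 + j) - 1 / (a - 1 + ((j + 1 : ℕ) : ℝ))) :=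
        sum_le_sum fun j _ => key j
    _ = 1 / (a - 1) - 1 / (a - 1 + L) := by
        rw [Finset.sum_range_sub' (fun j => 1 / (a - 1 + j))]
        simp
    _ ≤ 1 / (a - 1) := by
        have : 0 ≤ 1 / (a - 1 + L) := by
          have : (0:ℝ) ≤ L := Nat.cast_nonneg L
          exact div_nonneg zero_le_one (by linarith)
        linarith

/-- **A block of shifted logarithms, from above**: `∑_{j<L} (log(a+δ+j) − log(a+j)) ≤ δ log((a+L−1)/(a−1))`
(`a > 1`, `δ ≥ 0`). [cite: LaiYu2020, §4 proof of Lemma 4.1, eqs. (4.12)–(4.13)] -/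
theorem block_diff_le {a δ : ℝ} (ha : 1 < a) (hδ0 : 0 ≤ δ) (L : ℕ) :
    ∑ j ∈ range L, (Real.log (a + δ + j) - Real.log (a + j)) ≤ δ * Real.log ((a + L - 1) / (a - 1)) := by
  have hterm : ∀ j ∈ range L, Real.log (a + δ + j) - Real.log (a + j) ≤ δ * (1 / (a + j)) := by
    intro j _
    have hj0 : (0 : ℝ) ≤ j := Nat.cast_nonneg j
    have hpos : 0 < a + j := by linarith
    rw [← Real.log_div (by linarith) hpos.ne', show (a + δ + j) / (a + j) = 1 + δ / (a + j) by field_simp; ring]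
    calc Real.log (1 + δ / (a + j)) ≤ δ / (a + j) := by
          have h0 : 0 < 1 + δ / (a + j) := by positivity
          linarith [Real.log_le_sub_one_of_pos h0]
      _ = δ * (1 / (a + j)) := by ring
  calc ∑ j ∈ range L, (Real.log (a + δ + j) - Real.log (a + j)) ≤ ∑ j ∈ range L, δ * (1 / (a + j)) :=
        sum_le_sum hterm
    _ = δ * ∑ j ∈ range L, 1 / (a + j) := by rw [mul_sum]
    _ ≤ δ * Real.log ((a + L - 1) / (a - 1)) := mul_le_mul_of_nonneg_left (FischlerSprangZudilin2019.Lemma3.sum_inv_le_log ha L) hδ0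

/-- **A block of shifted logarithms, from below**: `δ log((a+L)/a) − δ/(a−1) ≤ ∑_{j<L} (log(a+δ+j) − log(a+j))`
(`a > 1`, `0 ≤ δ ≤ 1`). [cite: LaiYu2020, §4 proof of Lemma 4.1, eqs. (4.12)–(4.13)] -/
theorem le_block_diff {a δ : ℝ} (ha : 1 < a) (hδ0 : 0 ≤ δ) (hδ1 : δ ≤ 1) (L : ℕ) :
    δ * Real.log ((a + L) / a) - δ / (a - 1) ≤ ∑ j ∈ range L, (Real.log (a + δ + j) - Real.log (a + j)) := by
  have hterm : ∀ j ∈ range L, δ * (1 / (a + j)) - δ * (1 / (a + j) ^ 2) ≤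
      Real.log (a + δ + j) - Real.log (a + j) := by
    intro j _
    have hj0 : (0 : ℝ) ≤ j := Nat.cast_nonneg j
    have hpos : 0 < a + j := by linarith
    rw [← Real.log_div (by linarith) hpos.ne', show (a + δ + j) / (a + j) = 1 + δ / (a + j) by field_simp; ring]
    have h := GammaRatio.sub_sq_le_log_one_add (show 0 ≤ δ / (a + j) by positivity)
    have hδsq : (δ / (a + j)) ^ 2 ≤ δ * (1 / (a + j) ^ 2) := by
      rw [div_pow, show δ * (1 / (a + j) ^ 2) = δ / (a + j) ^ 2 by ring]
      exact div_le_div_of_nonneg_right (by nlinarith) (by positivity)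
    calc δ * (1 / (a + j)) - δ * (1 / (a + j) ^ 2) ≤ δ / (a + j) - (δ / (a + j)) ^ 2 := by
          rw [show δ * (1 / (a + j)) = δ / (a + j) by ring]; linarith
      _ ≤ _ := h
  calc δ * Real.log ((a + L) / a) - δ / (a - 1) ≤ δ * ∑ j ∈ range L, 1 / (a + j) - δ * ∑ j ∈ range L, 1 / (a + j) ^ 2 := by
        have h1 := mul_le_mul_of_nonneg_left (FischlerSprangZudilin2019.Lemma3.log_le_sum_inv (by linarith : 0 < a) L) hδ0
        have h2 := mul_le_mul_of_nonneg_left (sum_inv_sq_le ha L) hδ0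
        rw [show δ / (a - 1) = δ * (1 / (a - 1)) by ring]
        linarith
    _ = ∑ j ∈ range L, (δ * (1 / (a + j)) - δ * (1 / (a + j) ^ 2)) := by rw [mul_sum, mul_sum, sum_sub_distrib]
    _ ≤ _ := sum_le_sum hterm

/-! ### The four comparison inequalities of logarithms of ratios -/

/-- `log((k−1+L)/(k−1)) ≤ log((k+L)/k) + 1/(k−1)` (`k ≥ 2`). [cite: LaiYu2020, §4 proof of Lemma 4.1, eq. (4.13)] -/
theorem log_ratio_cmp₁ {k : ℕ} (hk : 2 ≤ k) (L : ℕ) :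
    Real.log (((k : ℝ) + L - 1) / ((k : ℝ) - 1)) ≤ Real.log (((k : ℝ) + L) / k) + 1 / ((k : ℝ) - 1) := by
  have hk' : (2 : ℝ) ≤ k := by exact_mod_cast hk
  have hL : (0 : ℝ) ≤ L := Nat.cast_nonneg L
  have hkm1 : 0 < (k : ℝ) - 1 := by linarith
  refine log_le_log_add (div_pos (by linarith) hkm1) (div_pos (by linarith) (by linarith))
    (one_div_pos.2 hkm1).le ?_
  have e : ((k : ℝ) + L) / k * (1 + 1 / ((k : ℝ) - 1)) = ((k : ℝ) + L) / ((k : ℝ) - 1) := by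
    field_simp
    ring
  rw [e]
  exact div_le_div_of_nonneg_right (by linarith) hkm1.le

/-- `log((k+L)/k) ≤ log((k+2+L)/(k+2)) + 2/k` (`k ≥ 1`). [cite: LaiYu2020, §4 proof of Lemma 4.1, eq. (4.13)] -/
theorem log_ratio_cmp₂ {k : ℕ} (hk : 1 ≤ k) (L : ℕ) :
    Real.log (((k : ℝ) + L) / k) ≤ Real.log (((k : ℝ) + 2 + L) / ((k : ℝ) + 2)) + 2 / (k : ℝ) := by
  have hk' : (1 : ℝ) ≤ k := by exact_mod_cast hk
  have hL : (0 : ℝ) ≤ L := Nat.cast_nonneg L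
  refine log_le_log_add (div_pos (by linarith) (by linarith)) (div_pos (by linarith) (by linarith))
    (by positivity) ?_
  have e : ((k : ℝ) + 2 + L) / ((k : ℝ) + 2) * (1 + 2 / (k : ℝ)) = ((k : ℝ) + 2 + L) / k := by
    field_simp
  rw [e]
  exact div_le_div_of_nonneg_right (by linarith) (by linarith)

/-- `log((P+n)/(P−1)) ≤ log((P+n)/P) + 1/(P−1)` (`P ≥ 2`). [cite: LaiYu2020, §4 proof of Lemma 4.1, eq. (4.13)] -/
theorem log_ratio_cmp₃ {P : ℝ} (hP : 2 ≤ P) (n : ℕ) :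
    Real.log ((P + n) / (P - 1)) ≤ Real.log ((P + n) / P) + 1 / (P - 1) := by
  have hn : (0 : ℝ) ≤ n := Nat.cast_nonneg n
  have hP1 : 0 < P - 1 := by linarith
  refine log_le_log_add (div_pos (by linarith) hP1) (div_pos (by linarith) (by linarith))
    (one_div_pos.2 hP1).le (le_of_eq ?_)
  field_simp
  ring

/-- `log((P+n)/P) ≤ log((P+n+2)/(P+1)) + 1/P` (`P ≥ 1`). [cite: LaiYu2020, §4 proof of Lemma 4.1, eq. (4.13)] -/
theorem log_ratio_cmp₄ {P : ℝ} (hP : 1 ≤ P) (n : ℕ) :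
    Real.log ((P + n) / P) ≤ Real.log ((P + n + 2) / (P + 1)) + 1 / P := by
  have hn : (0 : ℝ) ≤ n := Nat.cast_nonneg n
  refine log_le_log_add (div_pos (by linarith) (by linarith)) (div_pos (by linarith) (by linarith))
    (by positivity) ?_
  have e : (P + n + 2) / (P + 1) * (1 + 1 / P) = (P + n + 2) / P := by
    field_simp
  rw [e]
  exact div_le_div_of_nonneg_right (by linarith) (by linarith)

/-! ### The numerator and denominator blocks against `(1−θ) log f(k/n)` -/

/-- **Numerator block**: for `a ∈ (k, k+2]` (`a = k+θ+θ'`), `k ≥ 2`, `0 ≤ δ ≤ 1`: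
`|∑_{j<L} (log(a+δ+j) − log(a+j)) − δ log((k+L)/k)| ≤ 4/(k−1)`.
[cite: LaiYu2020, §4 proof of Lemma 4.1, eq. (4.13) (the factor ((κ+2r+1)/κ)^{|𝓕_B|(1−θ)})] -/
theorem num_block_ratio {k : ℕ} (hk : 2 ≤ k) {a δ : ℝ} (hak : (k : ℝ) < a) (hak2 : a ≤ (k : ℝ) + 2)
    (hδ0 : 0 ≤ δ) (hδ1 : δ ≤ 1) (L : ℕ) :
    |∑ j ∈ range L, (Real.log (a + δ + j) - Real.log (a + j)) - δ * Real.log (((k : ℝ) + L) / k)| ≤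
      4 / ((k : ℝ) - 1) := by
  have hk' : (2 : ℝ) ≤ k := by exact_mod_cast hk
  have hL : (0 : ℝ) ≤ L := Nat.cast_nonneg L
  have ha1 : 1 < a := by linarith
  have hkm1 : 0 < (k : ℝ) - 1 := by linarith
  have hU := block_diff_le ha1 hδ0 L
  have hLo := le_block_diff ha1 hδ0 hδ1 L
  -- upper chain
  have hu1 : Real.log ((a + L - 1) / (a - 1)) ≤ Real.log (((k : ℝ) + L - 1) / ((k : ℝ) - 1)) := by
    refine Real.log_le_log (div_pos (by linarith) (by linarith)) ?_
    rw [div_le_div_iff₀ (by linarith) hkm1]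
    nlinarith
  have hu2 := log_ratio_cmp₁ hk L
  -- lower chain
  have hl1 : Real.log (((k : ℝ) + 2 + L) / ((k : ℝ) + 2)) ≤ Real.log ((a + L) / a) := by
    refine Real.log_le_log (div_pos (by linarith) (by linarith)) ?_
    rw [div_le_div_iff₀ (by linarith) (by linarith)]
    nlinarith
  have hl2 := log_ratio_cmp₂ (by omega : 1 ≤ k) L
  have hl3 : δ / (a - 1) ≤ 1 / ((k : ℝ) - 1) := by
    rw [div_le_div_iff₀ (by linarith) hkm1]; nlinarith
  have hk1 : 1 / (k : ℝ) ≤ 1 / ((k : ℝ) - 1) := one_div_le_one_div_of_le hkm1 (by linarith)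
  set T := Real.log (((k : ℝ) + L) / k) with hT
  have hT0 : 0 ≤ T := Real.log_nonneg (by rw [le_div_iff₀ (by linarith)]; linarith)
  rw [abs_le]
  constructor
  · -- lower
    have h1 : δ * Real.log (((k : ℝ) + 2 + L) / ((k : ℝ) + 2)) ≥ δ * (T - 2 / k) :=
      mul_le_mul_of_nonneg_left (by linarith) hδ0
    have h2 : δ * (2 / (k : ℝ)) ≤ 2 / ((k : ℝ) - 1) := by
      calc δ * (2 / (k : ℝ)) ≤ 1 * (2 / (k : ℝ)) := mul_le_mul_of_nonneg_right hδ1 (by positivity)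
        _ = 2 * (1 / (k : ℝ)) := by ring
        _ ≤ 2 * (1 / ((k : ℝ) - 1)) := by linarith
        _ = 2 / ((k : ℝ) - 1) := by ring
    have h3 := mul_le_mul_of_nonneg_left hl1 hδ0
    have : (4 : ℝ) / ((k : ℝ) - 1) = 2 / ((k : ℝ) - 1) + 1 / ((k : ℝ) - 1) + 1 / ((k : ℝ) - 1) := by ring
    have hpos : (0 : ℝ) ≤ 1 / ((k : ℝ) - 1) := (one_div_pos.2 hkm1).le
    linarith
  · -- upper
    have h1 := mul_le_mul_of_nonneg_left (hu1.trans hu2) hδ0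
    have h2 : δ * (1 / ((k : ℝ) - 1)) ≤ 1 / ((k : ℝ) - 1) := by
      calc δ * (1 / ((k : ℝ) - 1)) ≤ 1 * (1 / ((k : ℝ) - 1)) :=
            mul_le_mul_of_nonneg_right hδ1 (by positivity)
        _ = _ := one_mul _
    have : (1 : ℝ) / ((k : ℝ) - 1) ≤ 4 / ((k : ℝ) - 1) := div_le_div_of_nonneg_right (by norm_num) hkm1.le
    linarith

/-- **Denominator block**: for `w ∈ (P, P+1]` (`w = rn+k+θ`, `P = rn+k ≥ k+1`), `k ≥ 2`, `0 ≤ δ ≤ 1`: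
`|∑_{j ≤ n} (log(w+δ+j) − log(w+j)) − δ log((P+n)/P)| ≤ 3/k`.
[cite: LaiYu2020, §4 proof of Lemma 4.1, eq. (4.13) (the factor ((κ+r)/(κ+r+1))^{(s+1)(1−θ)})] -/
theorem den_block_ratio {k : ℕ} (hk : 2 ≤ k) {P w δ : ℝ} (hPk : (k : ℝ) + 1 ≤ P) (hw : P < w) (hw1 : w ≤ P + 1)
    (hδ0 : 0 ≤ δ) (hδ1 : δ ≤ 1) (n : ℕ) :
    |∑ j ∈ range (n + 1), (Real.log (w + δ + j) - Real.log (w + j)) - δ * Real.log ((P + n) / P)| ≤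
      3 / (k : ℝ) := by
  have hk' : (2 : ℝ) ≤ k := by exact_mod_cast hk
  have hn : (0 : ℝ) ≤ n := Nat.cast_nonneg n
  have hw1' : 1 < w := by linarith
  have hU := block_diff_le hw1' hδ0 (n + 1)
  have hLo := le_block_diff hw1' hδ0 hδ1 (n + 1)
  push_cast at hU hLo
  have hP1 : 0 < P - 1 := by linarith
  -- upper chain: (w+n)/(w-1) ≤ (P+n)/(P-1), then cmp₃
  have hu1 : Real.log ((w + (n + 1) - 1) / (w - 1)) ≤ Real.log ((P + n) / (P - 1)) := by
    refine Real.log_le_log (div_pos (by linarith) (by linarith)) ?_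
    rw [div_le_div_iff₀ (by linarith) hP1]
    nlinarith
  have hu2 := log_ratio_cmp₃ (by linarith : 2 ≤ P) n
  -- lower chain: (P+n+2)/(P+1) ≤ (w+n+1)/w, then cmp₄
  have hl1 : Real.log ((P + n + 2) / (P + 1)) ≤ Real.log ((w + (n + 1)) / w) := by
    refine Real.log_le_log (div_pos (by linarith) (by linarith)) ?_
    rw [div_le_div_iff₀ (by linarith) (by linarith)]
    nlinarith
  have hl2 := log_ratio_cmp₄ (by linarith : 1 ≤ P) n
  have hl3 : δ / (w - 1) ≤ 1 / (k : ℝ) := by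
    rw [div_le_div_iff₀ (by linarith) (by linarith)]; nlinarith
  have hPinv : 1 / (P - 1) ≤ 1 / (k : ℝ) := one_div_le_one_div_of_le (by linarith) (by linarith)
  have hPinv' : 1 / P ≤ 1 / (k : ℝ) := one_div_le_one_div_of_le (by linarith) (by linarith)
  set T := Real.log ((P + n) / P) with hT
  have hT0 : 0 ≤ T := Real.log_nonneg (by rw [le_div_iff₀ (by linarith)]; linarith)
  have hk0 : (0 : ℝ) < 1 / k := one_div_pos.2 (by linarith)
  have hP0 : (0 : ℝ) < 1 / P := one_div_pos.2 (by linarith)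
  have hP10 : (0 : ℝ) < 1 / (P - 1) := one_div_pos.2 hP1
  rw [abs_le]
  constructor
  · have h1 := mul_le_mul_of_nonneg_left (le_trans (by linarith [hl2]) hl1 : T - 1 / P ≤ _) hδ0
    have h2 : δ * (1 / P) ≤ 1 / (k : ℝ) := by
      calc δ * (1 / P) ≤ 1 * (1 / P) := mul_le_mul_of_nonneg_right hδ1 hP0.le
        _ ≤ 1 / (k : ℝ) := by linarith
    have : (3 : ℝ) / k = 1 / k + 1 / k + 1 / k := by ring
    linarith
  · have h1 := mul_le_mul_of_nonneg_left (hu1.trans hu2) hδ0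
    have h2 : δ * (1 / (P - 1)) ≤ 1 / (k : ℝ) := by
      calc δ * (1 / (P - 1)) ≤ 1 * (1 / (P - 1)) := mul_le_mul_of_nonneg_right hδ1 hP10.le
        _ ≤ 1 / (k : ℝ) := by linarith
    have : (1 : ℝ) / k ≤ 3 / k := div_le_div_of_nonneg_right (by norm_num) (by linarith)
    linarith

/-! ### The logarithm of the term ratio against `(1−θ) log f(k/n)` -/

/-- `log f(k/n)` in terms of `k`, `n = vm`, `L = (2u+v)m`, `rn = um`:
`φ(k/n) = N(log(k+L) − log k) + (s+1)(log(um+k) − log(um+k+n))`.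
[cite: LaiYu2020, §4 proof of Lemma 4.1, eq. (4.13) (κ = k/n)] -/
theorem phiLY_div {u v s N : ℕ} (hv : 1 ≤ v) {m k : ℕ} (hm : 1 ≤ m) (hk : 1 ≤ k) :
    phiLY u v s N ((k : ℝ) / ((v * m : ℕ) : ℝ)) =
      (N : ℝ) * (Real.log ((k : ℝ) + (((2 * u + v) * m : ℕ) : ℝ)) - Real.log k) +
        ((s : ℝ) + 1) * (Real.log ((u : ℝ) * m + k) - Real.log ((u : ℝ) * m + k + ((v * m : ℕ) : ℝ))) := by
  have hv0 : (0 : ℝ) < v := by exact_mod_cast hv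
  have hm0 : (0 : ℝ) < m := by exact_mod_cast hm
  have hk0 : (0 : ℝ) < k := by exact_mod_cast hk
  have hn0 : (0 : ℝ) < ((v * m : ℕ) : ℝ) := by push_cast; positivity
  have e1 : (k : ℝ) / ((v * m : ℕ) : ℝ) + (2 * (u : ℝ) + v) / v = ((k : ℝ) + (((2 * u + v) * m : ℕ) : ℝ)) /
      ((v * m : ℕ) : ℝ) := by
    push_cast; field_simp
  have e2 : (k : ℝ) / ((v * m : ℕ) : ℝ) + (u : ℝ) / v = ((u : ℝ) * m + k) / ((v * m : ℕ) : ℝ) := by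
    push_cast; field_simp; ring
  have e3 : (k : ℝ) / ((v * m : ℕ) : ℝ) + (u : ℝ) / v + 1 = ((u : ℝ) * m + k + ((v * m : ℕ) : ℝ)) /
      ((v * m : ℕ) : ℝ) := by
    push_cast; field_simp; ring
  unfold phiLY
  rw [e1, e3, e2, Real.log_div (by positivity) hn0.ne', Real.log_div hk0.ne' hn0.ne',
    Real.log_div (by positivity) hn0.ne', Real.log_div (by positivity) hn0.ne']
  ring

/-- **The logarithm of the term ratio**: for `k ≥ 2`, `m ≥ 1`, `um ≥ 1`, `0 < θ ≤ 1`,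
`|log R̂_n(k+1) − log R̂_n(k+θ) − (1−θ) log f(k/n)| ≤ (2 + 4N + 3(s+1))/(k−1)` — the printed (4.13),
`R̂_n(k+1)/R̂_n(k+θ) = (1+o(1)) f(κ)^{1−θ}` uniformly on compact `κ`-ranges, in quantitative form.
[cite: LaiYu2020, §4 proof of Lemma 4.1, eq. (4.13)] -/
theorem abs_log_ratio_sub_le {u v s : ℕ} {B : ℝ} {m : ℕ} (hv : 1 ≤ v) (hm : 1 ≤ m) (hum : 1 ≤ u * m)
    {θ : ℚ} (hθ0 : 0 < θ) (hθ1 : θ ≤ 1) {k : ℕ} (hk : 2 ≤ k) :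
    |Real.log (cT u v s B m 1 k) - Real.log (cT u v s B m θ k) -
        (1 - (θ : ℝ)) * phiLY u v s (zeroSet_finite B).toFinset.card ((k : ℝ) / ((v * m : ℕ) : ℝ))| ≤
      (2 + 4 * ((zeroSet_finite B).toFinset.card : ℝ) + 3 * ((s : ℝ) + 1)) / ((k : ℝ) - 1) := by
  have hθ0' : (0 : ℝ) < θ := by exact_mod_cast hθ0
  have hθ1' : (θ : ℝ) ≤ 1 := by exact_mod_cast hθ1
  have hk' : (2 : ℝ) ≤ k := by exact_mod_cast hk
  have hkm1 : 0 < (k : ℝ) - 1 := by linarith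
  have hum' : (1 : ℝ) ≤ (u : ℝ) * m := by exact_mod_cast hum
  rw [log_cT_eq u v s B m one_pos k, log_cT_eq u v s B m hθ0 k, phiLY_div hv hm (by omega : 1 ≤ k)]
  simp only [Rat.cast_one]
  set N : ℕ := (zeroSet_finite B).toFinset.card with hN
  set L : ℕ := (2 * u + v) * m with hL
  set n : ℕ := v * m with hn
  set δ : ℝ := 1 - (θ : ℝ) with hδ
  set P : ℝ := (u : ℝ) * m + k with hP
  have hδ0 : 0 ≤ δ := by rw [hδ]; linarith
  have hδ1 : δ ≤ 1 := by rw [hδ]; linarith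
  have hL0 : (0 : ℝ) ≤ L := Nat.cast_nonneg L
  have hn0 : (0 : ℝ) ≤ n := Nat.cast_nonneg n
  have hPk : (k : ℝ) + 1 ≤ P := by rw [hP]; linarith
  -- (1) the first factor
  set X1 := Real.log ((k : ℝ) + 1) - Real.log ((k : ℝ) + θ) with hX1
  have h1 : |X1| ≤ 1 / ((k : ℝ) - 1) := by
    have hpos : 0 < (k : ℝ) + θ := by linarith
    rw [hX1, ← Real.log_div (by linarith) hpos.ne',
      show ((k : ℝ) + 1) / ((k : ℝ) + θ) = 1 + δ / ((k : ℝ) + θ) by rw [hδ]; field_simp; ring]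
    have hy : 0 ≤ δ / ((k : ℝ) + θ) := by positivity
    rw [abs_of_nonneg (Real.log_nonneg (by linarith))]
    calc Real.log (1 + δ / ((k : ℝ) + θ)) ≤ δ / ((k : ℝ) + θ) := by
          linarith [Real.log_le_sub_one_of_pos (show 0 < 1 + δ / ((k : ℝ) + θ) by linarith)]
      _ ≤ 1 / ((k : ℝ) - 1) := by rw [div_le_div_iff₀ hpos hkm1]; nlinarith
  -- (2) numerator blocks
  set X2 := ∑ θ' ∈ (zeroSet_finite B).toFinset, ∑ j ∈ range L,
      (Real.log (((k : ℝ) + 1 + θ') + j) - Real.log (((k : ℝ) + θ + θ') + j)) -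
        (N : ℝ) * (δ * Real.log (((k : ℝ) + L) / k)) with hX2
  have h2 : ∀ θ' ∈ (zeroSet_finite B).toFinset,
      |∑ j ∈ range L, (Real.log (((k : ℝ) + 1 + θ') + j) - Real.log (((k : ℝ) + θ + θ') + j)) -
        δ * Real.log (((k : ℝ) + L) / k)| ≤ 4 / ((k : ℝ) - 1) := by
    intro θ' hθ'
    obtain ⟨hp, hle⟩ := mem_toFinset_pos hθ'
    have hp' : (0 : ℝ) < θ' := by exact_mod_cast hp
    have hle' : (θ' : ℝ) ≤ 1 := by exact_mod_cast hle
    have e : ∀ j : ℕ, ((k : ℝ) + 1 + θ') + (j : ℝ) = ((k : ℝ) + θ + θ') + δ + j := fun j => by rw [hδ]; ring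
    simp_rw [e]
    exact num_block_ratio hk (by linarith) (by linarith) hδ0 hδ1 L
  have h2sum : |X2| ≤ (N : ℝ) * (4 / ((k : ℝ) - 1)) := by
    have e : X2 = ∑ θ' ∈ (zeroSet_finite B).toFinset, (∑ j ∈ range L,
          (Real.log (((k : ℝ) + 1 + θ') + j) - Real.log (((k : ℝ) + θ + θ') + j)) -
          δ * Real.log (((k : ℝ) + L) / k)) := by
      rw [hX2, sum_sub_distrib, sum_const, ← hN, nsmul_eq_mul]
    rw [e]
    refine (abs_sum_le_sum_abs _ _).trans ?_
    have := sum_le_sum h2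
    rw [sum_const, ← hN, nsmul_eq_mul] at this
    exact this
  -- (3) denominator block
  set X3 := ∑ j ∈ range (n + 1), (Real.log ((P + 1) + j) - Real.log ((P + θ) + j)) -
      δ * Real.log ((P + n) / P) with hX3
  have h3 : |X3| ≤ 3 / ((k : ℝ) - 1) := by
    have e : ∀ j : ℕ, (P + 1) + (j : ℝ) = (P + θ) + δ + j := fun j => by rw [hδ]; ring
    have h := den_block_ratio hk (P := P) (w := P + θ) (δ := δ) hPk (by linarith) (by linarith) hδ0 hδ1 n
    simp_rw [hX3, e]
    refine h.trans ?_
    exact div_le_div_of_nonneg_left (by norm_num) hkm1 (by linarith)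
  -- the expression is X1 + X2 − (s+1) X3
  have elog1 : Real.log (((k : ℝ) + L) / k) = Real.log ((k : ℝ) + L) - Real.log k :=
    Real.log_div (by linarith) (by linarith)
  have elog2 : Real.log ((P + n) / P) = Real.log (P + n) - Real.log P :=
    Real.log_div (by linarith) (by linarith)
  have key : Real.log ((k : ℝ) + 1) +
        ∑ θ' ∈ (zeroSet_finite B).toFinset, ∑ j ∈ range L, Real.log (((k : ℝ) + 1 + θ') + j) -
        ((s : ℝ) + 1) * ∑ j ∈ range (n + 1), Real.log ((P + 1) + j) -
      (Real.log ((k : ℝ) + θ) +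
        ∑ θ' ∈ (zeroSet_finite B).toFinset, ∑ j ∈ range L, Real.log (((k : ℝ) + θ + θ') + j) -
        ((s : ℝ) + 1) * ∑ j ∈ range (n + 1), Real.log ((P + θ) + j)) -
      δ * ((N : ℝ) * (Real.log ((k : ℝ) + L) - Real.log k) + ((s : ℝ) + 1) * (Real.log P - Real.log (P + n))) =
      X1 + X2 - ((s : ℝ) + 1) * X3 := by
    simp only [hX1, hX2, hX3, elog1, elog2, sum_sub_distrib]
    ring
  have hgoal : Real.log (pref u v s B m) + Real.log ((k : ℝ) + 1) +
        ∑ θ' ∈ (zeroSet_finite B).toFinset, ∑ j ∈ range L, Real.log (((k : ℝ) + 1 + θ') + j) -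
        ((s : ℝ) + 1) * ∑ j ∈ range (n + 1), Real.log (((u : ℝ) * m + k + 1) + j) -
      (Real.log (pref u v s B m) + Real.log ((k : ℝ) + θ) +
        ∑ θ' ∈ (zeroSet_finite B).toFinset, ∑ j ∈ range L, Real.log (((k : ℝ) + θ + θ') + j) -
        ((s : ℝ) + 1) * ∑ j ∈ range (n + 1), Real.log (((u : ℝ) * m + k + θ) + j)) -
      δ * ((N : ℝ) * (Real.log ((k : ℝ) + L) - Real.log k) +
        ((s : ℝ) + 1) * (Real.log ((u : ℝ) * m + k) - Real.log ((u : ℝ) * m + k + n))) =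
      X1 + X2 - ((s : ℝ) + 1) * X3 := by
    rw [← key, hP]
    ring
  rw [hgoal]
  have hs0 : (0 : ℝ) ≤ (s : ℝ) + 1 := by positivity
  have htri : |X1 + X2 - ((s : ℝ) + 1) * X3| ≤ |X1| + |X2| + ((s : ℝ) + 1) * |X3| := by
    calc |X1 + X2 - ((s : ℝ) + 1) * X3| ≤ |X1 + X2| + |((s : ℝ) + 1) * X3| := abs_sub _ _
      _ ≤ |X1| + |X2| + |((s : ℝ) + 1) * X3| := by linarith [abs_add_le X1 X2]
      _ = |X1| + |X2| + ((s : ℝ) + 1) * |X3| := by rw [abs_mul, abs_of_nonneg hs0]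
  have hsum : |X1| + |X2| + ((s : ℝ) + 1) * |X3| ≤
      1 / ((k : ℝ) - 1) + (N : ℝ) * (4 / ((k : ℝ) - 1)) + ((s : ℝ) + 1) * (3 / ((k : ℝ) - 1)) :=
    add_le_add (add_le_add h1 h2sum) (mul_le_mul_of_nonneg_left h3 hs0)
  have hfin : 1 / ((k : ℝ) - 1) + (N : ℝ) * (4 / ((k : ℝ) - 1)) + ((s : ℝ) + 1) * (3 / ((k : ℝ) - 1)) ≤
      (2 + 4 * (N : ℝ) + 3 * ((s : ℝ) + 1)) / ((k : ℝ) - 1) := by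
    have e : 1 / ((k : ℝ) - 1) + (N : ℝ) * (4 / ((k : ℝ) - 1)) + ((s : ℝ) + 1) * (3 / ((k : ℝ) - 1)) =
        (1 + 4 * (N : ℝ) + 3 * ((s : ℝ) + 1)) / ((k : ℝ) - 1) := by
      field_simp
    rw [e]
    exact div_le_div_of_nonneg_right (by linarith) hkm1.le
  exact htri.trans (hsum.trans hfin)

/-! ### The window `(x₀−δ)n ≤ k ≤ (x₀+δ)n` -/

/-- `φ = log f` is continuous at `x₀ > 0`. [cite: LaiYu2020, §4 proof of Lemma 4.1 ("letting ε₀ → 0⁺")] -/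
theorem continuousAt_phiLY {u v : ℕ} (hv : 1 ≤ v) (s N : ℕ) {x₀ : ℝ} (hx₀ : 0 < x₀) :
    ContinuousAt (phiLY u v s N) x₀ :=
  (hasDerivAt_phi hv s N hx₀).continuousAt

/-- `|ρ − 1| ≤ 2η` when `|log ρ| ≤ η ≤ 1` (`ρ > 0`). [cite: LaiYu2020, §4 proof of Lemma 4.1, eq. (4.13) ("(1+o(1))")] -/
theorem abs_sub_one_le_of_abs_log_le {ρ η : ℝ} (hρ : 0 < ρ) (h : |Real.log ρ| ≤ η) (hη : η ≤ 1) :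
    |ρ - 1| ≤ 2 * η := by
  have hexp := Real.abs_exp_sub_one_le (x := Real.log ρ) (h.trans hη)
  rw [Real.exp_log hρ] at hexp
  linarith

/-- **Window arithmetic**: if `m ≥ (4 + 2T)/x₀` (`T ≥ 0`), `n = vm ≥ m`, `δ ≤ x₀/2` and `(x₀−δ)n ≤ k`, then `k ≥ 2`
and `T ≤ k − 1`. [cite: LaiYu2020, §4 proof of Lemma 4.1 ("provided n is sufficiently large")] -/
theorem window_arith {x₀ δ T : ℝ} (hx₀ : 0 < x₀) (hδx : δ ≤ x₀ / 2) (hT : 0 ≤ T) {m n k : ℕ}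
    (hm : (4 + 2 * T) / x₀ ≤ m) (hmn : (m : ℝ) ≤ n) (hk : (x₀ - δ) * (n : ℝ) ≤ k) :
    2 ≤ k ∧ T ≤ (k : ℝ) - 1 := by
  have h1 : x₀ / 2 * (n : ℝ) ≤ k := le_trans (mul_le_mul_of_nonneg_right (by linarith) (Nat.cast_nonneg n)) hk
  have h2 : x₀ / 2 * ((4 + 2 * T) / x₀) = 2 + T := by field_simp; ring
  have h3 : x₀ / 2 * ((4 + 2 * T) / x₀) ≤ x₀ / 2 * (n : ℝ) :=
    mul_le_mul_of_nonneg_left (hm.trans hmn) (by linarith)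
  have hk2 : (2 : ℝ) + T ≤ k := by linarith
  exact ⟨by exact_mod_cast (show (2 : ℝ) ≤ k by linarith), by linarith⟩

/-- **Uniform in-window estimate** (the printed (4.13)): for every `ε > 0` there are `δ > 0` (`δ ≤ x₀/2`) and `M`
with `|R̂_n(k+1)/R̂_n(k+θ) − 1| ≤ ε` for all `m ≥ M`, all `k` with `(x₀−δ)n ≤ k ≤ (x₀+δ)n` (`n = vm`) and all
`θ ∈ (0,1]`, where `x₀ > 0` is the root of `f` (`log f(x₀) = 0`).
[cite: LaiYu2020, §4 proof of Lemma 4.1, eq. (4.13)] -/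
theorem window_ratio {u v s : ℕ} {B : ℝ} (hu : 1 ≤ u) (hv : 1 ≤ v) {x₀ : ℝ} (hx₀ : 0 < x₀)
    (hf1 : fLY u v s (zeroSet_finite B).toFinset.card x₀ = 1) {ε : ℝ} (hε : 0 < ε) :
    ∃ δ : ℝ, 0 < δ ∧ δ ≤ x₀ / 2 ∧ ∃ M : ℕ, ∀ m : ℕ, M ≤ m → ∀ k : ℕ,
      (x₀ - δ) * ((v * m : ℕ) : ℝ) ≤ k → (k : ℝ) ≤ (x₀ + δ) * ((v * m : ℕ) : ℝ) → ∀ θ : ℚ, 0 < θ → θ ≤ 1 →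
        |cT u v s B m 1 k / cT u v s B m θ k - 1| ≤ ε := by
  set N : ℕ := (zeroSet_finite B).toFinset.card with hN
  set ε' : ℝ := min (ε / 4) (1 / 4) with hε'
  have hε'0 : 0 < ε' := lt_min (by linarith) (by norm_num)
  have hε'1 : ε' ≤ ε / 4 := min_le_left _ _
  have hε'2 : ε' ≤ 1 / 4 := min_le_right _ _
  -- continuity of φ at x₀, φ(x₀) = 0
  have hphi0 : phiLY u v s N x₀ = 0 := by
    rw [← log_fLY hv s N hx₀, hN, hf1, Real.log_one]
  have hcont := continuousAt_phiLY (u := u) hv s N hx₀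
  rw [Metric.continuousAt_iff] at hcont
  obtain ⟨δ₁, hδ₁, hδ₁P⟩ := hcont ε' hε'0
  set δ : ℝ := min (δ₁ / 2) (x₀ / 2) with hδ
  have hδ0 : 0 < δ := lt_min (by linarith) (by linarith)
  have hδx : δ ≤ x₀ / 2 := min_le_right _ _
  have hδδ₁ : δ ≤ δ₁ / 2 := min_le_left _ _
  -- the constant of the log-ratio estimate and the threshold
  set C : ℝ := 2 + 4 * (N : ℝ) + 3 * ((s : ℝ) + 1) with hC
  have hC0 : 0 < C := by rw [hC]; positivity
  set T : ℝ := C / ε' with hT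
  have hT0 : 0 ≤ T := by positivity
  obtain ⟨M, hM⟩ := exists_nat_ge ((4 + 2 * T) / x₀ + 1)
  refine ⟨δ, hδ0, hδx, M, fun m hm k hk1 hk2 θ hθ0 hθ1 => ?_⟩
  have hMle : (M : ℝ) ≤ m := by exact_mod_cast hm
  have hmT : (4 + 2 * T) / x₀ ≤ m := by linarith
  have hm1 : 1 ≤ m := by
    have : (0 : ℝ) ≤ (4 + 2 * T) / x₀ := by positivity
    exact_mod_cast (show (1 : ℝ) ≤ m by linarith)
  have hum : 1 ≤ u * m := by nlinarith
  have hv1 : (1 : ℝ) ≤ v := by exact_mod_cast hv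
  have hn_ge : (m : ℝ) ≤ ((v * m : ℕ) : ℝ) := by
    push_cast; nlinarith [(Nat.cast_nonneg m : (0:ℝ) ≤ m)]
  obtain ⟨hk2', hkT⟩ := window_arith hx₀ hδx hT0 hmT hn_ge hk1
  have hk' : (2 : ℝ) ≤ k := by exact_mod_cast hk2'
  have hCk : C / ((k : ℝ) - 1) ≤ ε' := by
    rw [div_le_iff₀ (by linarith)]
    rw [hT, div_le_iff₀ hε'0] at hkT
    linarith
  -- |φ(k/n)| ≤ ε'
  have hn0 : (0 : ℝ) < ((v * m : ℕ) : ℝ) := by linarith [show (1:ℝ) ≤ m by exact_mod_cast hm1]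
  have hdist : dist ((k : ℝ) / ((v * m : ℕ) : ℝ)) x₀ < δ₁ := by
    rw [Real.dist_eq, abs_lt]
    constructor
    · have : x₀ - δ ≤ (k : ℝ) / ((v * m : ℕ) : ℝ) := by rw [le_div_iff₀ hn0]; exact hk1
      linarith
    · have : (k : ℝ) / ((v * m : ℕ) : ℝ) ≤ x₀ + δ := by rw [div_le_iff₀ hn0]; exact hk2
      linarith
  have hphi : |phiLY u v s N ((k : ℝ) / ((v * m : ℕ) : ℝ))| ≤ ε' := by
    have := hδ₁P hdist
    rw [hphi0, Real.dist_eq, sub_zero] at this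
    exact this.le
  -- the log of the ratio
  have hθ1' : (θ : ℝ) ≤ 1 := by exact_mod_cast hθ1
  have hmain := abs_log_ratio_sub_le (s := s) (B := B) hv hm1 hum hθ0 hθ1 hk2'
  rw [← hN] at hmain
  have hc1 := cT_pos u v s B m one_pos k
  have hcθ := cT_pos u v s B m hθ0 k
  have hlogρ : Real.log (cT u v s B m 1 k / cT u v s B m θ k) =
      Real.log (cT u v s B m 1 k) - Real.log (cT u v s B m θ k) := Real.log_div hc1.ne' hcθ.ne'
  have habs : |Real.log (cT u v s B m 1 k / cT u v s B m θ k)| ≤ 2 * ε' := by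
    have h1 : |(1 - (θ : ℝ)) * phiLY u v s N ((k : ℝ) / ((v * m : ℕ) : ℝ))| ≤ ε' := by
      rw [abs_mul, abs_of_nonneg (by linarith)]
      calc (1 - (θ : ℝ)) * |phiLY u v s N ((k : ℝ) / ((v * m : ℕ) : ℝ))| ≤ 1 * ε' :=
            mul_le_mul (by linarith [(show (0:ℝ) < θ by exact_mod_cast hθ0)]) hphi (abs_nonneg _) zero_le_one
        _ = ε' := one_mul _
    rw [hlogρ]
    have := abs_sub_abs_le_abs_sub (Real.log (cT u v s B m 1 k) - Real.log (cT u v s B m θ k))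
      ((1 - (θ : ℝ)) * phiLY u v s N ((k : ℝ) / ((v * m : ℕ) : ℝ)))
    have hC' : (2 + 4 * (N : ℝ) + 3 * ((s : ℝ) + 1)) / ((k : ℝ) - 1) ≤ ε' := by rw [← hC]; exact hCk
    linarith [hmain.trans hC']
  have := abs_sub_one_le_of_abs_log_le (div_pos hc1 hcθ) habs (by linarith)
  linarith

/-! ### The off-window part is negligible; the ratio -/

/-- `E · exp(n(−κ + d_m) + C(1 + log(n+1))) → 0` along `n = vm` when `d_m → 0`, `κ > 0`.
[cite: LaiYu2020, §4 proof of Lemma 4.1, eq. (4.11) ("n^{O(1)} max(h(x₀−ε₀),h(x₀+ε₀))ⁿ")] -/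
theorem tendsto_exp_form_mul {v : ℕ} (hv : 1 ≤ v) {d : ℕ → ℝ} (hd : Tendsto d atTop (𝓝 0)) {κ : ℝ}
    (hκ : 0 < κ) (C E : ℝ) :
    Tendsto (fun m : ℕ => E * Real.exp (((v * m : ℕ) : ℝ) * (-κ + d m) +
      C * (1 + Real.log (((v * m : ℕ) : ℝ) + 1)))) atTop (𝓝 0) := by
  have hu := tendsto_one_add_log_div_mul hv
  have hinner : Tendsto (fun m : ℕ => -κ + d m + C * ((1 + Real.log (((v * m : ℕ) : ℝ) + 1)) / ((v * m : ℕ) : ℝ)))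
      atTop (𝓝 (-κ)) := by
    simpa using (tendsto_const_nhds.add hd).add (hu.const_mul C)
  have hn : Tendsto (fun m : ℕ => ((v * m : ℕ) : ℝ)) atTop atTop :=
    tendsto_natCast_atTop_atTop.comp (tendsto_id.const_mul_atTop' hv)
  have hprod := hn.atTop_mul_neg (by linarith) hinner
  have hexp := Real.tendsto_exp_atBot.comp hprod
  have := hexp.const_mul E
  rw [mul_zero] at this
  refine this.congr' ?_
  filter_upwards [eventually_ge_atTop 1] with m hm
  have : (0 : ℝ) < ((v * m : ℕ) : ℝ) := by
    have : 1 ≤ v * m := by nlinarith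
    exact_mod_cast this
  simp only [Function.comp_apply]
  congr 2
  field_simp

/-- **The final inequalities** (the printed step from (4.10), (4.11), (4.13) to the two-sided bound for
`r_{n,1}/r_{n,θ}`): if `r₁ = W₁ + O₁`, `r_θ = W_θ + O_θ` with `0 ≤ O ≤ ε' r`, and
`(1−ε')W_θ ≤ W₁ ≤ (1+ε')W_θ`, `ε' ≤ min(ε/4, 1/4)`, then `|r₁/r_θ − 1| < ε`.
[cite: LaiYu2020, §4 proof of Lemma 4.1 (the display after (4.13))] -/
theorem ratio_close {ε ε' r₁ rθ W₁ Wθ O₁ Oθ : ℝ} (hε : 0 < ε) (hε'0 : 0 < ε') (hε'1 : ε' ≤ ε / 4)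
    (hε'2 : ε' ≤ 1 / 4) (hrθ : 0 < rθ) (hr₁ : r₁ = W₁ + O₁) (hrθ' : rθ = Wθ + Oθ) (hO₁0 : 0 ≤ O₁)
    (hOθ0 : 0 ≤ Oθ) (hO₁ : O₁ ≤ ε' * r₁) (hOθ : Oθ ≤ ε' * rθ) (hW1 : (1 - ε') * Wθ ≤ W₁)
    (hW2 : W₁ ≤ (1 + ε') * Wθ) : |r₁ / rθ - 1| < ε := by
  have hWθ_ge : (1 - ε') * rθ ≤ Wθ := by nlinarith
  have hWθ_le : Wθ ≤ rθ := by linarith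
  have hε'3 : 0 ≤ 1 - ε' := by linarith
  rw [abs_lt]
  constructor
  · -- lower
    have h1 : (1 - ε') * ((1 - ε') * rθ) ≤ (1 - ε') * Wθ := mul_le_mul_of_nonneg_left hWθ_ge hε'3
    have h2 : W₁ ≤ r₁ := by linarith
    have h3 : 0 ≤ ε' * (ε' * rθ) := by positivity
    have h4 : ε' * rθ ≤ ε / 4 * rθ := mul_le_mul_of_nonneg_right hε'1 hrθ.le
    have h5 : 0 < ε * rθ := mul_pos hε hrθ
    rw [lt_sub_iff_add_lt, lt_div_iff₀ hrθ]
    nlinarith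
  · -- upper
    have h1 : (1 + ε') * Wθ ≤ (1 + ε') * rθ := mul_le_mul_of_nonneg_left hWθ_le (by linarith)
    have hA' : (1 - ε') * r₁ ≤ (1 + ε') * rθ := by nlinarith
    have h3 : ε' * ε' ≤ 1 / 4 * ε' := mul_le_mul_of_nonneg_right hε'2 hε'0.le
    have h4 : ε' * ε' * rθ ≤ 1 / 4 * ε' * rθ := mul_le_mul_of_nonneg_right h3 hrθ.le
    have h5 : 0 ≤ ε' * rθ := by positivity
    have hB' : (1 + ε') * rθ ≤ (1 - ε') * ((1 + 3 * ε') * rθ) := by nlinarith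
    have hC' : r₁ ≤ (1 + 3 * ε') * rθ := le_of_mul_le_mul_left (hA'.trans hB') (by linarith)
    have h6 : ε' * rθ ≤ ε / 4 * rθ := mul_le_mul_of_nonneg_right hε'1 hrθ.le
    have h7 : 0 < ε * rθ := mul_pos hε hrθ
    rw [sub_lt_iff_lt_add, div_lt_iff₀ hrθ]
    nlinarith

set_option maxHeartbeats 800000 in
/-- **Lai–Yu 2020, Lemma 4.1, second assertion** (PROVED): for every `θ ∈ (0,1]` (in particular every
`θ ∈ 𝓕_B`), `r_{n,1}/r_{n,θ} → 1` along the admissible `n = vm → ∞` (`u, v ≥ 1`, `s ≥ 2`,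
`(2u+v)|𝓕_B| < (s+1)v`; `x₀` the positive root of `f`).
[cite: LaiYu2020, Lemma 4.1 ("for any θ ∈ 𝓕_B, we have lim_{n→+∞} r_{n,1}/r_{n,θ} = 1")] -/
theorem tendsto_ratio {u v s : ℕ} {B : ℝ} (hu : 1 ≤ u) (hv : 1 ≤ v) (hs : 2 ≤ s)
    (hNs : (2 * u + v) * (zeroSet_finite B).toFinset.card < (s + 1) * v) {x₀ : ℝ} (hx₀ : 0 < x₀)
    (hf1 : fLY u v s (zeroSet_finite B).toFinset.card x₀ = 1)
    (hlt : ∀ x, 0 < x → x < x₀ → 1 < fLY u v s (zeroSet_finite B).toFinset.card x)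
    (hgt : ∀ x, x₀ < x → fLY u v s (zeroSet_finite B).toFinset.card x < 1)
    {θ : ℚ} (hθ0 : 0 < θ) (hθ1 : θ ≤ 1) :
    Tendsto (fun m : ℕ => rT u v s B m 1 / rT u v s B m θ) atTop (𝓝 1) := by
  set g₀ := Real.exp (Lam u v s B x₀) with hg₀
  have hg : 0 < g₀ := Real.exp_pos _
  obtain ⟨A, hA, hAx, hAg⟩ := exists_A (u := u) (s := s) (B := B) hv hNs (x₀ := x₀) hg
  obtain ⟨B', hB', hbody⟩ := exists_body_bound u v s B hv A
  rw [Metric.tendsto_atTop]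
  intro ε hε
  -- ε' and the window
  set ε' : ℝ := min (ε / 4) (1 / 4) with hε'
  have hε'0 : 0 < ε' := lt_min (by linarith) (by norm_num)
  have hε'1 : ε' ≤ ε / 4 := min_le_left _ _
  have hε'2 : ε' ≤ 1 / 4 := min_le_right _ _
  obtain ⟨δ, hδ0, hδx, M₁, hwin⟩ := window_ratio (s := s) (B := B) hu hv hx₀ hf1 hε'0
  obtain ⟨η, hη0, -, hgap⟩ := Lam_gap hv hx₀ hlt hgt hδ0 (by linarith)
  -- the off-window ratio Θ_m → 0
  set d : ℕ → ℝ := fun m => Lam u v s B x₀ -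
    Lam u v s B (((⌊x₀ * ((v * m : ℕ) : ℝ)⌋₊ : ℝ) + 1) / ((v * m : ℕ) : ℝ)) with hd
  have hd0 : Tendsto d atTop (𝓝 0) := by
    have := (((continuous_Lam u v s B).tendsto x₀).comp (tendsto_floor_succ_div hv hx₀.le)).const_sub
      (Lam u v s B x₀)
    rw [sub_self] at this
    exact this
  have hT := (tendsto_exp_form_mul hv hd0 hη0 (2 * B' + 1) ((A : ℝ) + 1)).add
    (tendsto_exp_form_mul hv hd0 (Real.log_pos one_lt_two) B' 2)
  rw [add_zero] at hT
  obtain ⟨M₂, hM₂⟩ := eventually_atTop.1 (hT.eventually (Iio_mem_nhds hε'0))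
  refine ⟨max (max M₁ M₂) 1, fun m hm => ?_⟩
  have hm1 : 1 ≤ m := le_trans (le_max_right _ _) hm
  have hmM₁ : M₁ ≤ m := le_trans ((le_max_left _ _).trans (le_max_left _ _)) hm
  have hmM₂ : M₂ ≤ m := le_trans ((le_max_right _ _).trans (le_max_left _ _)) hm
  have hum : 1 ≤ u * m := by nlinarith
  have hn1 : 1 ≤ v * m := by nlinarith
  have hn' : (1 : ℝ) ≤ ((v * m : ℕ) : ℝ) := by exact_mod_cast hn1
  have hln0 : 0 ≤ Real.log (((v * m : ℕ) : ℝ) + 1) := Real.log_nonneg (by linarith)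
  -- Θ_m < ε'
  have hΘε : ((A : ℝ) + 1) * Real.exp (((v * m : ℕ) : ℝ) * (-η + d m) +
      (2 * B' + 1) * (1 + Real.log (((v * m : ℕ) : ℝ) + 1))) +
      2 * Real.exp (((v * m : ℕ) : ℝ) * (-Real.log 2 + d m) + B' * (1 + Real.log (((v * m : ℕ) : ℝ) + 1))) < ε' :=
    hM₂ m hmM₂
  -- lower bound μ of r_{n,θ''} for every θ''
  set μ : ℝ := Real.exp (((v * m : ℕ) : ℝ) * Lam u v s B (((⌊x₀ * ((v * m : ℕ) : ℝ)⌋₊ : ℝ) + 1) /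
    ((v * m : ℕ) : ℝ)) - B' * (1 + Real.log (((v * m : ℕ) : ℝ) + 1))) with hμ
  have hμ_pos : 0 < μ := Real.exp_pos _
  have hμ_le : ∀ θ'' : ℚ, 0 < θ'' → θ'' ≤ 1 → μ ≤ rT u v s B m θ'' := by
    intro θ'' h0 h1
    have hk := floor_succ_le_mul hx₀.le hAx hn1
    have h := (cT_exp_bounds (u := u) (v := v) (s := s) (B := B) (m := m) h0
      ((hbody m _ θ'' hm1 hum h0 h1 hk).2 (by omega))).2
    simp only [Nat.cast_succ] at h
    refine h.trans ?_
    rw [rT]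
    exact (summable_cT hv hm1 hs hNs.le h0 h1).le_tsum _ (fun k _ => (cT_pos u v s B m h0 k).le)
  -- the decomposition r = W + O with O ≤ Θ μ
  set inwin : ℕ → Prop := fun k => (x₀ - δ) * ((v * m : ℕ) : ℝ) ≤ k ∧
    (k : ℝ) ≤ (x₀ + δ) * ((v * m : ℕ) : ℝ) with hinwin
  set W : ℚ → ℝ := fun θ'' => ∑ k ∈ range (A * (v * m) + 1) with inwin k, cT u v s B m θ'' k with hW
  set O : ℚ → ℝ := fun θ'' => (∑ k ∈ range (A * (v * m) + 1) with ¬inwin k, cT u v s B m θ'' k) +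
    ∑' q : ℕ, cT u v s B m θ'' (q + (A * (v * m) + 1)) with hO
  have hrWO : ∀ θ'' : ℚ, 0 < θ'' → θ'' ≤ 1 → rT u v s B m θ'' = W θ'' + O θ'' := by
    intro θ'' h0 h1
    rw [hW, hO]
    simp only
    rw [rT_eq_sum_add_tail hv hm1 hs hNs.le h0 h1 (A * (v * m) + 1), ← add_assoc,
      sum_filter_add_sum_filter_not]
  have hO0 : ∀ θ'' : ℚ, 0 < θ'' → θ'' ≤ 1 → 0 ≤ O θ'' := fun θ'' h0 h1 => by
    rw [hO]
    exact add_nonneg (sum_nonneg fun k _ => (cT_pos u v s B m h0 k).le)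
      (tsum_nonneg fun q => (cT_pos u v s B m h0 _).le)
  have hO_le : ∀ θ'' : ℚ, 0 < θ'' → θ'' ≤ 1 → O θ'' ≤ ε' * μ := by
    intro θ'' h0 h1
    -- non-window body terms
    have hterm : ∀ k ∈ (range (A * (v * m) + 1)).filter (fun k => ¬inwin k),
        cT u v s B m θ'' k ≤ Real.exp (((v * m : ℕ) : ℝ) * (Lam u v s B x₀ - η) +
          B' * (1 + Real.log (((v * m : ℕ) : ℝ) + 1))) := by
      intro k hk
      simp only [Finset.mem_filter, Finset.mem_range, hinwin, not_and_or, not_le] at hk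
      obtain ⟨hkA, hkw⟩ := hk
      have hkA' : k ≤ A * (v * m) := by omega
      have h1' := (hbody m k θ'' hm1 hum h0 h1 hkA').1
      have hc := cT_pos u v s B m h0 k
      have hnpos : (0 : ℝ) < ((v * m : ℕ) : ℝ) := by linarith
      have hdist : δ ≤ |(k : ℝ) / ((v * m : ℕ) : ℝ) - x₀| := by
        rcases hkw with h | h
        · have : (k : ℝ) / ((v * m : ℕ) : ℝ) < x₀ - δ := by rw [div_lt_iff₀ hnpos]; linarith
          rw [abs_of_neg (by linarith)]; linarith
        · have : x₀ + δ < (k : ℝ) / ((v * m : ℕ) : ℝ) := by rw [lt_div_iff₀ hnpos]; linarith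
          rw [abs_of_pos (by linarith)]; linarith
      have hL := hgap ((k : ℝ) / ((v * m : ℕ) : ℝ)) (by positivity) hdist
      have hL' := mul_le_mul_of_nonneg_left hL hnpos.le
      calc cT u v s B m θ'' k = Real.exp (Real.log (cT u v s B m θ'' k)) := (Real.exp_log hc).symm
        _ ≤ Real.exp (((v * m : ℕ) : ℝ) * (Lam u v s B x₀ - η) + B' * (1 + Real.log (((v * m : ℕ) : ℝ) + 1))) :=
            Real.exp_le_exp.2 (by linarith)
    have hsum : ∑ k ∈ range (A * (v * m) + 1) with ¬inwin k, cT u v s B m θ'' k ≤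
        ((A * (v * m) + 1 : ℕ) : ℝ) * Real.exp (((v * m : ℕ) : ℝ) * (Lam u v s B x₀ - η) +
          B' * (1 + Real.log (((v * m : ℕ) : ℝ) + 1))) := by
      refine (sum_le_card_nsmul _ _ _ hterm).trans ?_
      rw [nsmul_eq_mul]
      refine mul_le_mul_of_nonneg_right ?_ (by positivity)
      exact_mod_cast (Finset.card_filter_le _ _).trans (Finset.card_range _).le
    have htail := tsum_tail_le_geom (m := m) hv hm1 hs hNs.le h0 h1 hA hAg
    -- rewrite both against μ
    have hAn1 : ((A * (v * m) + 1 : ℕ) : ℝ) ≤ ((A : ℝ) + 1) * Real.exp (Real.log (((v * m : ℕ) : ℝ) + 1)) := by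
      rw [Real.exp_log (by linarith)]
      push_cast
      have : (0 : ℝ) ≤ A := Nat.cast_nonneg A
      nlinarith
    have e1 : ((A : ℝ) + 1) * Real.exp (Real.log (((v * m : ℕ) : ℝ) + 1)) *
        Real.exp (((v * m : ℕ) : ℝ) * (Lam u v s B x₀ - η) + B' * (1 + Real.log (((v * m : ℕ) : ℝ) + 1))) ≤
        ((A : ℝ) + 1) * Real.exp (((v * m : ℕ) : ℝ) * (-η + d m) +
          (2 * B' + 1) * (1 + Real.log (((v * m : ℕ) : ℝ) + 1))) * μ := by
      rw [hμ, mul_assoc, mul_assoc, ← Real.exp_add, ← Real.exp_add]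
      refine mul_le_mul_of_nonneg_left (Real.exp_le_exp.2 ?_) (by positivity)
      simp only [hd]
      linarith
    have e2 : 2 * (g₀ / 2) ^ (v * m) =
        2 * Real.exp (((v * m : ℕ) : ℝ) * (-Real.log 2 + d m) + B' * (1 + Real.log (((v * m : ℕ) : ℝ) + 1))) * μ := by
      rw [hμ, mul_assoc, ← Real.exp_add, hd, hg₀]
      congr 1
      rw [show ((v * m : ℕ) : ℝ) * (-Real.log 2 + (Lam u v s B x₀ -
          Lam u v s B (((⌊x₀ * ((v * m : ℕ) : ℝ)⌋₊ : ℝ) + 1) / ((v * m : ℕ) : ℝ)))) +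
          B' * (1 + Real.log (((v * m : ℕ) : ℝ) + 1)) +
          (((v * m : ℕ) : ℝ) * Lam u v s B (((⌊x₀ * ((v * m : ℕ) : ℝ)⌋₊ : ℝ) + 1) / ((v * m : ℕ) : ℝ)) -
            B' * (1 + Real.log (((v * m : ℕ) : ℝ) + 1))) =
          ((v * m : ℕ) : ℝ) * (Lam u v s B x₀ - Real.log 2) by ring,
        Real.exp_nat_mul, Real.exp_sub, Real.exp_log (by norm_num : (0 : ℝ) < 2)]
    rw [hO]
    calc (∑ k ∈ range (A * (v * m) + 1) with ¬inwin k, cT u v s B m θ'' k) +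
          ∑' q : ℕ, cT u v s B m θ'' (q + (A * (v * m) + 1))
        ≤ ((A * (v * m) + 1 : ℕ) : ℝ) * Real.exp (((v * m : ℕ) : ℝ) * (Lam u v s B x₀ - η) +
            B' * (1 + Real.log (((v * m : ℕ) : ℝ) + 1))) + 2 * (g₀ / 2) ^ (v * m) := add_le_add hsum htail
      _ ≤ ((A : ℝ) + 1) * Real.exp (Real.log (((v * m : ℕ) : ℝ) + 1)) *
            Real.exp (((v * m : ℕ) : ℝ) * (Lam u v s B x₀ - η) + B' * (1 + Real.log (((v * m : ℕ) : ℝ) + 1))) +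
          2 * (g₀ / 2) ^ (v * m) := by gcongr
      _ ≤ ((A : ℝ) + 1) * Real.exp (((v * m : ℕ) : ℝ) * (-η + d m) +
            (2 * B' + 1) * (1 + Real.log (((v * m : ℕ) : ℝ) + 1))) * μ +
          2 * Real.exp (((v * m : ℕ) : ℝ) * (-Real.log 2 + d m) +
            B' * (1 + Real.log (((v * m : ℕ) : ℝ) + 1))) * μ := add_le_add e1 e2.le
      _ = (((A : ℝ) + 1) * Real.exp (((v * m : ℕ) : ℝ) * (-η + d m) +
            (2 * B' + 1) * (1 + Real.log (((v * m : ℕ) : ℝ) + 1))) +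
          2 * Real.exp (((v * m : ℕ) : ℝ) * (-Real.log 2 + d m) +
            B' * (1 + Real.log (((v * m : ℕ) : ℝ) + 1)))) * μ := by ring
      _ ≤ ε' * μ := mul_le_mul_of_nonneg_right hΘε.le hμ_pos.le
  -- window comparison: (1-ε') c_θ ≤ c_1 ≤ (1+ε') c_θ termwise
  have hterm2 : ∀ k ∈ (range (A * (v * m) + 1)).filter (fun k => inwin k),
      (1 - ε') * cT u v s B m θ k ≤ cT u v s B m 1 k ∧ cT u v s B m 1 k ≤ (1 + ε') * cT u v s B m θ k := by
    intro k hk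
    simp only [Finset.mem_filter, hinwin] at hk
    obtain ⟨-, hk1, hk2⟩ := hk
    have h := hwin m hmM₁ k hk1 hk2 θ hθ0 hθ1
    have hc := cT_pos u v s B m hθ0 k
    rw [abs_le] at h
    obtain ⟨h1', h2'⟩ := h
    rw [le_sub_iff_add_le, le_div_iff₀ hc] at h1'
    rw [sub_le_iff_le_add, div_le_iff₀ hc] at h2'
    constructor <;> linarith
  have hWcmp : (1 - ε') * W θ ≤ W 1 ∧ W 1 ≤ (1 + ε') * W θ := by
    rw [hW]
    simp only
    rw [mul_sum, mul_sum]
    exact ⟨sum_le_sum fun k hk => (hterm2 k hk).1, sum_le_sum fun k hk => (hterm2 k hk).2⟩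
  have hrθpos := rT_pos hv hm1 hs hNs.le hθ0 hθ1 (B := B)
  have hr1pos := rT_pos hv hm1 hs hNs.le one_pos le_rfl (B := B) (u := u)
  have hOθ' : O θ ≤ ε' * rT u v s B m θ :=
    (hO_le θ hθ0 hθ1).trans (mul_le_mul_of_nonneg_left (hμ_le θ hθ0 hθ1) hε'0.le)
  have hO1' : O 1 ≤ ε' * rT u v s B m 1 :=
    (hO_le 1 one_pos le_rfl).trans (mul_le_mul_of_nonneg_left (hμ_le 1 one_pos le_rfl) hε'0.le)
  rw [Real.dist_eq]
  exact ratio_close hε hε'0 hε'1 hε'2 hrθpos (hrWO 1 one_pos le_rfl) (hrWO θ hθ0 hθ1)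
    (hO0 1 one_pos le_rfl) (hO0 θ hθ0 hθ1) hO1' hOθ' hWcmp.1 hWcmp.2

end Lemma41

end Literature.NumberTheory.Irrationality.LaiYu2020
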